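import Literature.AlgebraicGeometry.Hyperkaehler.GeneralizedKummerType
import Literature.AlgebraicTopology.SingularHomology.CupProduct
import HarnessLib

/-!
# The Hodge conjecture for hyperkähler varieties of generalized Kummer type — NAMED FACTS

Layer `Literature/AlgebraicGeometry/Hyperkaehler`.  CITE records owed by the Hodge-ladder stage-4
scoping (run/shared/lean/pub/hodge-director/STAGE4-ABELIAN-MOTIVIC-TYPE.md, row 2b) once the
predicate `IsOfGeneralizedKummerType` (file `GeneralizedKummerType`) exists: the Hodge conjecture is a
THEOREM in print for projective manifolds of `Kum²`-type and of `Kum³`-type, and holds on the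
subalgebra generated by `H²` for every `Kumⁿ`-type, `n ≥ 2`.  None of these uses the Hodge conjecture
for abelian varieties as an input (their inputs in print: O'Grady 2021 / Markman 2023 on the
intermediate Jacobian `J³(X)`, an abelian fourfold of Weil type; Voisin 2022 "footnotes"; Varesco
2023; Foster 2023; Hassett–Tschinkel 2013; the K3 surface `S_K` of Floccari 2024).

## Sources (read: arXiv texts `paper:arxiv-2308.02267`, `paper:arxiv-2308.04865`)

* S. Floccari, *The Hodge and Tate conjectures for hyper-Kähler sixfolds of generalized Kummer type*
  (arXiv:2308.02267, 2023), Theorem 1.1 (§1), verbatim: "Let `K` be a projective manifold of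
  `Kum³`-type. Then the Hodge conjecture holds for `K`, i.e., any cohomology class in
  `H^{i,i}(K) ∩ H^{2i}(K, ℚ)` is a `ℚ`-linear combination of fundamental classes of subvarieties of
  `K`, for any `i`."  (Theorem 1.2: the strong Tate conjecture for `Kum³`-type over finitely generated
  `k ⊂ ℂ` — not recorded here.)
* S. Floccari, M. Varesco, *Algebraic cycles on hyper-Kähler varieties of generalized Kummer type*,
  Math. Ann. 391 (2024) (arXiv:2308.04865), Theorem 1.1 (§1), verbatim: "Let `X` be a projective
  manifold of `Kumⁿ`-type, `n ≥ 2`. Denote by `A₂•(X) ⊂ H•(X, ℚ)` the subalgebra of the rational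
  cohomology generated by `H²(X, ℚ)`. Then any Hodge class in `A₂^{2j}(X) ∩ H^{j,j}(X)` is algebraic,
  for any `j`."; after it: "For `j ≤ n`, cup-product induces an isomorphism `A₂^{2j}(X) ≅ Symʲ(H²(X, ℚ))`
  of Hodge structures, by a theorem of Verbitsky. However, Theorem 1.1 is not sufficient to prove the
  Hodge conjecture for `X` (see [Green–Kim–Laza–Weyman 2019]). […] For `n = 2`, the Hodge classes in the
  complement of `A₂•(X)` form an `80`-dimensional subspace of the middle cohomology; Hassett and
  Tschinkel have shown that these Hodge classes are algebraic, for any `X` of `Kum²`-type. Hence,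
  Theorem 1.1 yields the following.  Corollary 1.2. Let `X` be a projective manifold of `Kum²`-type.
  Then the Hodge conjecture holds for `X`, i.e., `H^{j,j}(X) ∩ H^{2j}(X, ℚ)` consists of algebraic
  classes for any `j`."

## Rendering (tree carriers)

* "projective manifold of `Kumⁿ`-type": `Motives.IsSmoothProjective (2 * n) X ∧ IsOfGeneralizedKummerType n X`
  (file `GeneralizedKummerType`; smoothness is the companion hypothesis, as for `IsOfK3HilbertType`).
* "the Hodge conjecture holds for `X`": the tree's `HodgeTheory.HodgeConjectureFor (2 * n) X`
  (`HodgeTheory/HodgeConjecture`: a Hodge model exists — a theorem for smooth projective `X` — and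
  every rational `(j, j)`-class lies in `algebraicClasses X j`, the `ℂ`-span of cycle classes; the
  equivalence of `ℚ`-span and `ℂ`-span for rational classes is recalled in that file's docstring).
* "`A₂^{2j}(X)`": `degreeTwoGenerated X j`, the degree-`2j` piece of the `ℂ`-subalgebra of
  `H^{2•}(X(ℂ); ℂ)` generated by `H²(X(ℂ); ℂ)` under the tree's cup product
  (`AlgebraicTopology.SingularHomology.cupProduct`), defined by recursion on `j`
  (`degreeTwoGenerated X 0 = ⊤`, `degreeTwoGenerated X (j+1) = span {x ⌣ y | x ∈ H², y ∈ A₂^{2j}}`).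
  Since `H²(X(ℂ); ℂ) = H²(X, ℚ) ⊗ ℂ`, this is `A₂^{2j}(X) ⊗_ℚ ℂ`, and a RATIONAL class lies in it iff it
  lies in `A₂^{2j}(X)` (`(V ⊗ ℂ) ∩ H(ℚ) = V`); in degree `0` we take all of `H⁰` (`= ℂ · 1 = A₂⁰ ⊗ ℂ`
  for connected `X(ℂ)`, the case at hand).

## What is NOT here

The Tate-conjecture statements (Floccari Thm. 1.2, Floccari–Varesco Cor. 1.3); any proof; the
`n ≥ 4` case outside `A₂•(X)`, which is OPEN in print (Floccari–Varesco, remark after Thm. 1.1).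
-/

noncomputable section

open Literature.AlgebraicTopology.SingularHomology

namespace Literature.AlgebraicGeometry.Hyperkaehler

/-! ### The subalgebra generated by `H²` -/

/-- **`A₂^{2j}(X) ⊗ ℂ`** — the degree-`2j` piece of the subalgebra of the even complex cohomology
`H^{2•}(X(ℂ); ℂ)` generated by `H²(X(ℂ); ℂ)` under cup product (Floccari–Varesco 2024 §1:
"`A₂•(X) ⊂ H•(X, ℚ)` the subalgebra of the rational cohomology generated by `H²(X, ℚ)`", complexified),
by recursion: everything in degree `0`, and in degree `2(j+1)` the span of the products `x ⌣ y` with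
`x ∈ H²` and `y ∈ A₂^{2j}`. [cite: FloccariVaresco2024, §1 Thm. 1.1] -/
def degreeTwoGenerated (X : Motives.SchemeOver ℂ) : (j : ℕ) → Submodule ℂ (HodgeTheory.complexBetti X (2 * j))
  | 0 => ⊤
  | j + 1 => Submodule.span ℂ
      {c | ∃ (x : HodgeTheory.complexBetti X 2) (y : HodgeTheory.complexBetti X (2 * j)),
        y ∈ degreeTwoGenerated X j ∧ c = cupProduct (by omega) x y}

/-- In degree `0` the subalgebra generated by `H²` is everything (unfolding). [cite: FloccariVaresco2024, §1 Thm. 1.1] -/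
theorem degreeTwoGenerated_zero (X : Motives.SchemeOver ℂ) : degreeTwoGenerated X 0 = ⊤ := rfl

/-- In degree `2(j+1)`: the span of the products `x ⌣ y`, `x ∈ H²`, `y ∈ A₂^{2j}` (unfolding).
[cite: FloccariVaresco2024, §1 Thm. 1.1] -/
theorem degreeTwoGenerated_succ (X : Motives.SchemeOver ℂ) (j : ℕ) :
    degreeTwoGenerated X (j + 1) = Submodule.span ℂ
      {c | ∃ (x : HodgeTheory.complexBetti X 2) (y : HodgeTheory.complexBetti X (2 * j)),
        y ∈ degreeTwoGenerated X j ∧ c = cupProduct (by omega) x y} := rfl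

/-- A product `x ⌣ y` with `x ∈ H²` and `y ∈ A₂^{2j}` lies in `A₂^{2(j+1)}`. [cite: FloccariVaresco2024, §1 Thm. 1.1] -/
theorem cupProduct_mem_degreeTwoGenerated_succ {X : Motives.SchemeOver ℂ} {j : ℕ}
    (x : HodgeTheory.complexBetti X 2) {y : HodgeTheory.complexBetti X (2 * j)}
    (hy : y ∈ degreeTwoGenerated X j) :
    cupProduct (by omega) x y ∈ degreeTwoGenerated X (j + 1) := by
  rw [degreeTwoGenerated_succ]
  exact Submodule.subset_span ⟨x, y, hy, rfl⟩

/-! ### The named facts -/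

/-- **Floccari 2023, Theorem 1.1 — on a projective manifold `K` of `Kum³`-type every rational
`(i, i)`-class is algebraic, for every `i`** ("[…] any cohomology class in `H^{i,i}(K) ∩ H^{2i}(K, ℚ)`
is a `ℚ`-linear combination of fundamental classes of subvarieties of `K`, for any `i`"; full sentence
in the module docstring).  Rendering: for every smooth projective `K` of dimension `6` of `Kum³`-type
(`IsOfGeneralizedKummerType 3 K`), the tree's per-variety Hodge statement in dimension `6` (the body's
head symbol: a Hodge model exists and rational `(i, i)`-classes lie in `algebraicClasses K i`).  A
THEOREM in print (status: proved; unproved in the tree; its proof uses O'Grady 2021, Markman 2023,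
Voisin 2022, Varesco 2023 and the K3 surface `S_K` of Floccari 2024 — nothing about abelian varieties
in general enters). [cite: Floccari2023, Thm. 1.1 (§1)] -/
def Floccari2023_hodgeClasses_algebraic_kum3Type : Prop :=
  ∀ ⦃K : Motives.SchemeOver ℂ⦄, Motives.IsSmoothProjective 6 K → IsOfGeneralizedKummerType 3 K →
    HodgeTheory.HodgeConjectureFor 6 K

/-- **Floccari–Varesco 2024, Corollary 1.2 — on a projective manifold `X` of `Kum²`-type,
`H^{j,j}(X) ∩ H^{2j}(X, ℚ)` consists of algebraic classes for every `j`** (full sentence in the module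
docstring; Thm. 1.1 for the subalgebra generated by `H²`, and Hassett–Tschinkel for the
`80`-dimensional complement in `H⁴`).  Rendering: for every smooth projective `X` of dimension `4` of
`Kum²`-type, the tree's per-variety Hodge statement in dimension `4` (the body's head symbol).  A
THEOREM in print (status: proved; unproved in the tree). [cite: FloccariVaresco2024, Cor. 1.2 (§1)]
[cite: HassettTschinkel2010, Thm. 1.1] -/
def FloccariVaresco2024_hodgeClasses_algebraic_kum2Type : Prop :=
  ∀ ⦃X : Motives.SchemeOver ℂ⦄, Motives.IsSmoothProjective 4 X → IsOfGeneralizedKummerType 2 X →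
    HodgeTheory.HodgeConjectureFor 4 X

/-- **Floccari–Varesco 2024, Theorem 1.1 — Hodge classes in the subalgebra generated by `H²` are
algebraic on every projective `Kumⁿ`-type manifold, `n ≥ 2`.** "Let `X` be a projective manifold of
`Kumⁿ`-type, `n ≥ 2`. Denote by `A₂•(X) ⊂ H•(X, ℚ)` the subalgebra of the rational cohomology generated
by `H²(X, ℚ)`. Then any Hodge class in `A₂^{2j}(X) ∩ H^{j,j}(X)` is algebraic, for any `j`."  Rendering:
for `2 ≤ n`, `X` smooth projective of dimension `2n` of `Kumⁿ`-type, every class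
`c ∈ H^{2j}(X(ℂ); ℂ)` which is rational (`IsRationalClass`), of Hodge type `(j, j)` (`IsOfHodgeType`)
and lies in `degreeTwoGenerated X j` (`= A₂^{2j}(X) ⊗ ℂ`; for a rational class, membership is
membership in `A₂^{2j}(X)`) lies in `algebraicClasses X j`.  Printed caveat (loc. cit.): for `n ≥ 4`
this does NOT cover all Hodge classes of `X`.  A THEOREM in print (status: proved; unproved in the
tree). [cite: FloccariVaresco2024, Thm. 1.1 (§1)] -/
def FloccariVaresco2024_degreeTwoGenerated_hodgeClasses_algebraic : Prop :=
  ∀ (n : ℕ), 2 ≤ n → ∀ ⦃X : Motives.SchemeOver ℂ⦄, Motives.IsSmoothProjective (2 * n) X →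
    IsOfGeneralizedKummerType n X →
      ∀ (j : ℕ) (c : HodgeTheory.complexBetti X (2 * j)), HodgeTheory.IsRationalClass c →
        HodgeTheory.IsOfHodgeType (2 * n) X (2 * j) j j c → c ∈ degreeTwoGenerated X j →
          c ∈ HodgeTheory.algebraicClasses X j

/-- Kernel consequence: Floccari–Varesco's Cor. 1.2 in the `abbrev` spelling `IsOfGeneralizedKummerFourfoldType`.
[cite: FloccariVaresco2024, Cor. 1.2 (§1)] -/
theorem FloccariVaresco2024_hodgeClasses_algebraic_kum2Type.of_fourfoldType
    (h : FloccariVaresco2024_hodgeClasses_algebraic_kum2Type) {X : Motives.SchemeOver ℂ}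
    (hX : Motives.IsSmoothProjective 4 X) (hK : IsOfGeneralizedKummerFourfoldType X) :
    HodgeTheory.HodgeConjectureFor 4 X :=
  h hX hK

/-- Kernel consequence: Floccari's Thm. 1.1 in the `abbrev` spelling `IsOfGeneralizedKummerSixfoldType`.
[cite: Floccari2023, Thm. 1.1 (§1)] -/
theorem Floccari2023_hodgeClasses_algebraic_kum3Type.of_sixfoldType
    (h : Floccari2023_hodgeClasses_algebraic_kum3Type) {K : Motives.SchemeOver ℂ}
    (hK : Motives.IsSmoothProjective 6 K) (hKum : IsOfGeneralizedKummerSixfoldType K) :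
    HodgeTheory.HodgeConjectureFor 6 K :=
  h hK hKum

end Literature.AlgebraicGeometry.Hyperkaehler

end
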